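import Literature.Probability.RandomPlanarGeometry.SAWKestenRatioRateAllDim
import Literature.Probability.RandomPlanarGeometry.SAWKestenRatioRateZ2Sharp
import Literature.Probability.RandomPlanarGeometry.SAWLowerBound25
import Mathlib.Analysis.Complex.ExponentialBounds
import Mathlib.Analysis.Real.Pi.Bounds
import HarnessLib

/-!
# Kesten's ratio rate on `ℤ²` with the printed exponent and a NUMERAL constant:
# `|c_{N+2}/c_N − μ²| ≤ 10⁶ · N^{-1/3}` for every `N ≥ 1`

Topic `Literature/Probability/RandomPlanarGeometry` (continues `SAWKestenRatioRateAllDim.lean` — Madras–Slade (7.5.1)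
`|c_{N+2}/c_N − μ²| ≤ K N^{-1/3}` in every dimension with `∃ K N₀` — and `SAWKestenRatioRateZ2Sharp.lean` — the planar
Kesten inequality (7.3.3) with the explicit constant `kestenB 0 63 2.43` on standard axioms and the planar rate
`1.07·10⁷ √((G(2N)+1)/N)`).

Source: N. Madras, G. Slade, *The Self-Avoiding Walk* (1993), §7.5 Notes, eq. (7.5.1) (p. 255; Kesten 1963): "`|c_{N+2}/c_N − μ²|
≤ K N^{-1/3}` for all sufficiently large `N`"; the constant `K` is not made explicit in print.  THIS FILE proves, on `ℤ²` and on the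
standard axioms, the same statement with the printed exponent `1/3`, for EVERY `N ≥ 1`, and with a numeral: `K = 10⁶`.

Method.  The two abstract rate lemmas of the tree (`KestenRateUpper.upper_rate_cubeRoot_sub`, submultiplicativity at a short
length; `KestenRateLower.lower_rate_cubeRoot_ins`, insertion of closed loops) are re-proved here in a CASE form that keeps the three
raw inequalities `uN ≤ 8B`, `u²N ≤ K₂(N)`, `u³N ≤ K₃` separate (`upper_rate_cases`, `lower_rate_cases`), so that the final constant
is a genuine cube root rather than the crude `x³ ≤ K ⇒ x ≤ K`; the planar inputs are all explicit in the tree: Kesten's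
inequality with `B = kestenB 0 63 2.43 ≤ 2.92·10¹¹` (`kestenIneqZ2_sharp_25`), the Hammersley–Welsh envelope at the short length
(`RatioRateAllDim.count_two_mul_le_envelope`), the insertion inequality (`RatioRateAllDim.insertion_hSM`), and an all-`M` loop
lower envelope `e^{-12√M} μ^{2M} ≤ 4μ⁴ M⁶ c_{2M−1}(0,−e₂)` assembled here from `count_le_mul_exp_mul_bridgeCount`,
`pow_connectiveConstant_le_count` and Theorem 3.2.4 (`MadrasSlade1993_thm324_general`); `5/2 ≤ μ ≤ 3`.

## What is here (namespace `Literature.Probability.RandomPlanarGeometry.SAW.Zd`; all proved, axioms standard)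

* `RatioRateNumeral.upper_rate_cases`, `RatioRateNumeral.lower_rate_cases` — the abstract rate lemmas in case form;
* `RatioRateNumeral.loop_lower_envelope_two` — `e^{-12√M} μ^{2M} ≤ 4 μ⁴ M⁶ c_{2M−1}(0,−e₂)` on `ℤ²`, all `M ≥ 2`;
* `RatioRateNumeral.kestenB_sharp_25_le'` — `kestenB 0 63 2.43 ≤ 2.92·10¹¹` (the tree's `kestenB_sharp_25_le` says `≤ 1.06·10¹²`);
* **`ratioRate_two_cubeRoot_numeral`** — `∀ N ≥ 1, |c_{N+2}/c_N − μ²| ≤ 10⁶ · N^{-1/3}` on `ℤ²`.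

Honest size of the constant: any proof through Kesten's `B/N` perturbation has `K ≳ (B μ⁴ c²)^{1/3} ≈ 10⁵–10⁶` with the
tree's `B ≈ 2.9·10¹¹`; the bound is vacuous (`|c_{N+2}/c_N − μ²| ≤ 8` trivially, as `1 ≤ c_{N+2}/c_N ≤ 12` and
`25/4 ≤ μ² ≤ 9`) below `N ≈ 10¹⁵`.
-/

noncomputable section

open Filter Topology Finset Literature.Probability.LatticeModels SimpleGraph
open scoped BigOperators

namespace Literature.Probability.RandomPlanarGeometry.SAW.Zd

namespace RatioRateNumeral

/-! ### The cube root -/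

/-- The cube root: `t = N^{1/3}` satisfies `t³ = N`, `t ≥ 1` for `N ≥ 1`, and `N^{-1/3} = t⁻¹`. [folklore] -/
private theorem cubeRoot_facts {N : ℝ} (hN : 1 ≤ N) :
    0 < N ^ ((1 : ℝ) / 3) ∧ 1 ≤ N ^ ((1 : ℝ) / 3) ∧ (N ^ ((1 : ℝ) / 3)) ^ 3 = N ∧
      N ^ (-(1 : ℝ) / 3) = (N ^ ((1 : ℝ) / 3))⁻¹ := by
  have hN0 : 0 < N := by linarith
  refine ⟨Real.rpow_pos_of_pos hN0 _, Real.one_le_rpow hN (by norm_num), ?_, ?_⟩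
  · rw [← Real.rpow_natCast, ← Real.rpow_mul hN0.le]; norm_num
  · rw [show (-(1 : ℝ) / 3) = -((1 : ℝ) / 3) by ring, Real.rpow_neg hN0.le]

/-- `x ≤ K` from `x³ ≤ K³`, `K ≥ 0`. [folklore] -/
private theorem le_of_cube_le_cube {x K : ℝ} (hK : 0 ≤ K) (h : x ^ 3 ≤ K ^ 3) : x ≤ K :=
  le_of_pow_le_pow_left₀ (by norm_num) hK h

/-- `x ≤ K` from `x² ≤ K²`, `K ≥ 0`. [folklore] -/
private theorem le_of_sq_le_sq' {x K : ℝ} (hK : 0 ≤ K) (h : x ^ 2 ≤ K ^ 2) : x ≤ K :=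
  le_of_pow_le_pow_left₀ (by norm_num) hK h

/-! ### Planar numerics -/

/-- `kestenB 0 63 2.43 ≤ 2.92 · 10¹¹` (exact value `7 288 354 789 632 / 25 ≈ 2.9153 · 10¹¹`; the tree's `kestenB_sharp_25_le`
records the weaker `≤ 1.06 · 10¹²`). [cite: MadrasSlade1993, Lemma 7.3.1, eq. (7.3.3) (explicit constant, numeric bound)] -/
theorem kestenB_sharp_25_le' : KestenHairpin.kestenB 0 63 2.43 ≤ 2.92e11 := by
  unfold KestenHairpin.kestenB; norm_num

/-- `1 ≤ kestenB 0 63 2.43` and `9 ≤ kestenB 0 63 2.43`. [cite: MadrasSlade1993, Lemma 7.3.1, eq. (7.3.3) (explicit constant)] -/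
theorem nine_le_kestenB_sharp_25 : (9 : ℝ) ≤ KestenHairpin.kestenB 0 63 2.43 := by
  unfold KestenHairpin.kestenB; norm_num

/-- `5/2 ≤ μ(ℤ²) ≤ 3` on standard axioms. [cite: BDGS2012, §1.3, eq. (1.13)] -/
theorem mu_two_bounds : (5 / 2 : ℝ) ≤ connectiveConstant 2 ∧ connectiveConstant 2 ≤ 3 := by
  refine ⟨le_connectiveConstant_two_25, ?_⟩
  have h := connectiveConstant_le 2 (by norm_num)
  norm_num at h
  exact h

/-- `c_{N+2} ≤ 12 c_N` on `ℤ²` (`c_{N+2} ≤ c_N c_2`, `c_2 ≤ 4 · 3`). [cite: MadrasSlade1993, §1.2, eq. (1.2.3)] -/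
theorem count_add_two_le_twelve_mul (N : ℕ) : (count 2 (N + 2) : ℝ) ≤ 12 * count 2 N := by
  have h1 := count_add_le 2 N 2
  have h2 : count 2 2 ≤ 12 := by
    have := count_succ_le 2 1; norm_num at this; exact this
  have : count 2 (N + 2) ≤ 12 * count 2 N :=
    h1.trans (by rw [mul_comm]; exact Nat.mul_le_mul_right _ h2)
  exact_mod_cast this

/-! ### Elementary real lemmas -/

/-- `log(1+x) ≥ 2x/3` on `[0, 1/2]` (from `log y ≥ 1 − 1/y`). [folklore] -/
private theorem two_thirds_mul_le_log_one_add {x : ℝ} (hx0 : 0 ≤ x) (hx1 : x ≤ 1 / 2) :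
    2 * x / 3 ≤ Real.log (1 + x) := by
  have h := Real.one_sub_inv_le_log_of_pos (show 0 < 1 + x by linarith)
  have h2 : 2 * x / 3 ≤ 1 - (1 + x)⁻¹ := by
    have e : 1 - (1 + x)⁻¹ = x / (1 + x) := by field_simp; ring
    rw [e, div_le_div_iff₀ (by norm_num) (by linarith)]
    nlinarith
  linarith

/-- `-log(1-x) ≥ x` on `[0, 1)`. [folklore] -/
private theorem le_neg_log_one_sub {x : ℝ} (hx1 : x < 1) : x ≤ -Real.log (1 - x) := by
  have := Real.log_le_sub_one_of_pos (show 0 < 1 - x by linarith); linarith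

/-- Algebra. [folklore] -/
private theorem aux_A (u N B μ : ℝ) (hB : 0 < B) (hμ : 0 < μ) :
    u * N / (8 * B) * (u / (2 * μ ^ 2)) = u ^ 2 * N / (16 * B * μ ^ 2) := by
  field_simp
  ring

/-- Algebra. [folklore] -/
private theorem aux_B (u N B μ : ℝ) (hB : 0 < B) (hμ : 0 < μ) :
    u * N / (8 * B) * (u / (2 * μ ^ 2)) ^ 2 = u ^ 3 * N / (32 * B * μ ^ 4) := by
  field_simp
  ring

/-- The block count: for `y = uN/(4B) ≥ 2`, `M = ⌊y⌋` satisfies `2 ≤ M`, `M ≤ y`, `y/2 ≤ M`, hence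
`4 M B ≤ u N` and `u N/(8B) ≤ M`. [cite: MadrasSlade1993, Lemma 7.3.1 (proof: the number of iterations)] -/
private theorem blocks_facts {u N B : ℝ} (hB : 0 < B) (hy : 2 ≤ u * N / (4 * B)) :
    2 ≤ ⌊u * N / (4 * B)⌋₊ ∧ 4 * (⌊u * N / (4 * B)⌋₊ : ℝ) * B ≤ u * N ∧ u * N / (8 * B) ≤ ⌊u * N / (4 * B)⌋₊ := by
  set y : ℝ := u * N / (4 * B) with hy'
  have hy0 : 0 ≤ y := le_trans (by norm_num) hy
  set M : ℕ := ⌊y⌋₊ with hMdef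
  have hMle : (M : ℝ) ≤ y := Nat.floor_le hy0
  have hMlt : y < M + 1 := Nat.lt_floor_add_one y
  have hM2 : 2 ≤ M := by
    have : (2 : ℝ) ≤ M := by
      have := Nat.le_floor (show ((2 : ℕ) : ℝ) ≤ y by exact_mod_cast hy)
      exact_mod_cast this
    exact_mod_cast this
  refine ⟨hM2, ?_, ?_⟩
  · have := mul_le_mul_of_nonneg_right hMle (show (0 : ℝ) ≤ 4 * B by positivity)
    rw [hy', div_mul_cancel₀ _ (by positivity)] at this
    linarith
  · have e : u * N / (8 * B) = y / 2 := by rw [hy']; field_simp; ring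
    rw [e]; linarith

/-! ### The abstract UPPER rate lemma, case form -/

/-- **Upper deviation, case form.** For a positive sequence `a` with Kesten's inequality (7.3.3) (constant `B ≥ 1`, all
`n ≥ 1`), a second sequence `a₂` with `a_{N+2M} ≤ a_N · a₂(M)` and the short-length envelope `a₂(M) ≤ A e^{c√M} μ^{2M}`
(`μ, A ≥ 1`): if `N ≥ 1`, `0 < u ≤ μ²` and `μ² + u ≤ a_{N+2}/a_N`, then
`uN ≤ 8B`, or `u²N ≤ 48 B μ² log A`, or `u³N ≤ 288 B μ⁴ c²`.  (Forward iteration of (7.3.3) over `M = ⌊uN/(4B)⌋` blocks keeps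
the ratio above `μ² + u/2`; submultiplicativity and the envelope give `M log(1 + u/(2μ²)) ≤ log A + c√M`, and `log(1+x) ≥ 2x/3`
for `x ≤ 1/2`.) [cite: MadrasSlade1993, §7.5, eq. (7.5.1) (Kesten 1963: the exponent 1/3); Lemma 7.3.1; eq. (1.2.3)] -/
theorem upper_rate_cases {a a₂ : ℕ → ℝ} {μ B c A : ℝ} (ha : ∀ n, 0 < a n) (hμ : 1 ≤ μ)
    (hB1 : 1 ≤ B) (hA : 1 ≤ A)
    (hK : ∀ n : ℕ, 1 ≤ n → a (n + 2) / a n - B / n ≤ a (n + 4) / a (n + 2))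
    (hsub : ∀ N M : ℕ, a (N + 2 * M) ≤ a N * a₂ M)
    (hhi : ∀ M : ℕ, a₂ M ≤ A * Real.exp (c * Real.sqrt M) * μ ^ (2 * M))
    {N : ℕ} (hN : 1 ≤ N) {u : ℝ} (hu : 0 < u) (huμ : u ≤ μ ^ 2) (hdev : μ ^ 2 + u ≤ a (N + 2) / a N) :
    u * N ≤ 8 * B ∨ u ^ 2 * N ≤ 48 * B * μ ^ 2 * Real.log A ∨ u ^ 3 * N ≤ 288 * B * μ ^ 4 * c ^ 2 := by
  have hμ0 : 0 < μ := by linarith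
  have hB0 : 0 < B := by linarith
  have hA0 : 0 < A := by linarith
  set R : ℝ := Real.log A with hR
  have hR0 : 0 ≤ R := Real.log_nonneg hA
  have hNr : (1 : ℝ) ≤ N := by exact_mod_cast hN
  have hN0 : (0 : ℝ) < N := by linarith
  by_cases hsmall : u * N / (4 * B) < 2
  · left
    rw [div_lt_iff₀ (by positivity)] at hsmall; linarith
  · right
    push Not at hsmall
    obtain ⟨hM2, h4MB, hMy⟩ := blocks_facts hB0 hsmall
    set M : ℕ := ⌊u * N / (4 * B)⌋₊ with hMdef
    have hMr2 : (2 : ℝ) ≤ M := by exact_mod_cast hM2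
    have hM0 : (0 : ℝ) < M := by linarith
    -- forward product: `q^M a N ≤ a (N + 2M) ≤ a N * a₂ M`
    set q : ℝ := μ ^ 2 + u / 2 with hq
    have hq0 : 0 ≤ q := by positivity
    have hK' : ∀ n : ℕ, 1 ≤ n → (fun n => a (n + 2) / a n) n - B / n ≤ (fun n => a (n + 2) / a n) (n + 2) := by
      intro n hn; simpa [add_assoc] using hK n hn
    have hiter := kesten_iter_forward (φ := fun n => a (n + 2) / a n) (N₁ := 1) hB0.le hK' hN hN
    have hstep : ∀ k < M, q ≤ a (N + 2 * k + 2) / a (N + 2 * k) := by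
      intro k hk
      have h1 := hiter k
      have h2 : (k : ℝ) * B / N ≤ u / 2 := by
        rw [div_le_iff₀ hN0]
        have : (k : ℝ) * B ≤ M * B := mul_le_mul_of_nonneg_right (by exact_mod_cast hk.le) hB0.le
        nlinarith
      have e : a (N + 2 * k + 2) / a (N + 2 * k) = (fun n => a (n + 2) / a n) (N + 2 * k) := rfl
      rw [e]
      show μ ^ 2 + u / 2 ≤ a (N + 2 * k + 2) / a (N + 2 * k)
      have h3 : a (N + 2) / a N - k * B / N ≤ a (N + 2 * k + 2) / a (N + 2 * k) := by
        simpa using h1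
      linarith
    have hprod := kesten_prod_ge ha (n := N) (M := M) hq0 hstep
    have hqM : q ^ M ≤ A * Real.exp (c * Real.sqrt M) * μ ^ (2 * M) := by
      have h1 : q ^ M * a N ≤ a₂ M * a N := by rw [mul_comm (a₂ M)]; exact hprod.trans (hsub N M)
      exact (le_of_mul_le_mul_right h1 (ha N)).trans (hhi M)
    -- logs: `M log(1 + x) ≤ R + c√M`, `x = u/(2μ²) ≤ 1/2`
    set x : ℝ := u / (2 * μ ^ 2) with hx
    have hx0 : 0 < x := by positivity
    have hx1 : x ≤ 1 / 2 := by
      rw [hx, div_le_iff₀ (by positivity)]; linarith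
    have hqx : q = μ ^ 2 * (1 + x) := by rw [hq, hx]; field_simp
    have hlog1 : (M : ℝ) * Real.log (1 + x) ≤ R + c * Real.sqrt M := by
      have hpos1 : 0 < q ^ M := pow_pos (by positivity) M
      have h := Real.log_le_log hpos1 hqM
      have e1 : Real.log (q ^ M) = (M : ℝ) * (2 * Real.log μ + Real.log (1 + x)) := by
        rw [Real.log_pow, hqx, Real.log_mul (by positivity) (by positivity), Real.log_pow]; push_cast; ring
      have e2 : Real.log (A * Real.exp (c * Real.sqrt M) * μ ^ (2 * M)) =
          R + c * Real.sqrt M + (2 * (M : ℝ)) * Real.log μ := by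
        rw [Real.log_mul (by positivity) (by positivity), Real.log_mul (by positivity) (by positivity), Real.log_exp,
          Real.log_pow]; push_cast; ring
      rw [e1, e2] at h
      nlinarith [h]
    -- `M x ≤ (3/2)(R + c√M)`
    have hmain : (M : ℝ) * x ≤ 3 / 2 * R + 3 / 2 * (c * Real.sqrt M) := by
      have := mul_le_mul_of_nonneg_left (two_thirds_mul_le_log_one_add hx0.le hx1) hM0.le
      nlinarith
    rcases le_or_gt ((M : ℝ) * x) (3 * R) with hA' | hB'
    · -- (A): `u² N ≤ 48 B μ² R`
      left
      have h2 : u * N / (8 * B) * x ≤ 3 * R := le_trans (mul_le_mul_of_nonneg_right hMy hx0.le) hA'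
      rw [hx, aux_A u N B μ hB0 hμ0, div_le_iff₀ (by positivity)] at h2
      linarith
    · -- (B): `M x ≤ 3 c √M`, so `M x² ≤ 9 c²` and `u³ N ≤ 288 B μ⁴ c²`
      right
      have h1 : (M : ℝ) * x ≤ 3 * c * Real.sqrt M := by linarith
      have hsM : Real.sqrt (M : ℝ) ^ 2 = M := Real.sq_sqrt hM0.le
      have h2 : (M : ℝ) * x ^ 2 ≤ 9 * c ^ 2 := by
        have hl : 0 ≤ (M : ℝ) * x := by positivity
        have h3 : ((M : ℝ) * x) ^ 2 ≤ (3 * c * Real.sqrt M) ^ 2 := pow_le_pow_left₀ hl h1 2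
        have e : (3 * c * Real.sqrt (M : ℝ)) ^ 2 = 9 * c ^ 2 * M := by rw [mul_pow, mul_pow, hsM]; ring
        rw [e] at h3
        have e2 : ((M : ℝ) * x) ^ 2 = (M : ℝ) * ((M : ℝ) * x ^ 2) := by ring
        rw [e2] at h3
        have h4 : (M : ℝ) * ((M : ℝ) * x ^ 2) ≤ (M : ℝ) * (9 * c ^ 2) := by linarith
        exact le_of_mul_le_mul_left h4 hM0
      have h4 : u * N / (8 * B) * x ^ 2 ≤ 9 * c ^ 2 :=
        le_trans (mul_le_mul_of_nonneg_right hMy (by positivity)) h2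
      rw [hx, aux_B u N B μ hB0 hμ0, div_le_iff₀ (by positivity)] at h4
      linarith

/-! ### The abstract LOWER rate lemma, case form -/

/-- **Lower deviation, case form.** For a positive sequence `a` with Kesten's inequality (7.3.3) (constant `B ≥ max(1, μ²)`,
all `n ≥ 1`), an auxiliary sequence `e` with the lower envelope `e^{-c√M} μ^{2M} ≤ A M^p e_M` (`M ≥ 2`, `A ≥ 1`), and the
insertion inequality `a_{N'} e_M ≤ (2(N'+2M)+3)⁶ a_{N'+2M}` for `N' ≥ n₁` of parity `r` and `M ≥ 2`: if `N ≥ 2n₁ + 1` has parity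
`r`, `u > 0` and `a_{N+2}/a_N ≤ μ² − u`, then `uN ≤ 8B`, or `u²N ≤ 32 B μ² (log A + (p+6) log(2N+3))`, or `u³N ≤ 128 B μ⁴ c²`.
(Backward iteration of (7.3.3) over `M = ⌊uN/(4B)⌋` blocks keeps the ratio below `μ² − u/2` on `[N−2M, N]`; insertion and the
envelope give `M · u/(2μ²) ≤ log A + p log M + 6 log(2N+3) + c√M`.)
[cite: MadrasSlade1993, §7.5, eq. (7.5.1)–(7.5.2) (Kesten 1963: the exponent 1/3); Lemma 7.3.1; Corollary 3.2.6 (insertion)] -/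
theorem lower_rate_cases {a e : ℕ → ℝ} {μ B c A : ℝ} {p n₁ r : ℕ} (ha : ∀ n, 0 < a n) (hμ : 1 ≤ μ)
    (hB1 : 1 ≤ B) (hBμ : μ ^ 2 ≤ B) (hA : 1 ≤ A)
    (hK : ∀ n : ℕ, 1 ≤ n → a (n + 2) / a n - B / n ≤ a (n + 4) / a (n + 2))
    (hlo : ∀ M : ℕ, 2 ≤ M → Real.exp (-(c * Real.sqrt M)) * μ ^ (2 * M) ≤ A * (M : ℝ) ^ p * e M)
    (hSM : ∀ N' M : ℕ, n₁ ≤ N' → N' % 2 = r → 2 ≤ M →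
      a N' * e M ≤ (2 * ((N' : ℝ) + 2 * M) + 3) ^ 6 * a (N' + 2 * M))
    {N : ℕ} (hN : 2 * n₁ + 1 ≤ N) (hpar : N % 2 = r) {u : ℝ} (hu : 0 < u)
    (hdev : a (N + 2) / a N ≤ μ ^ 2 - u) :
    u * N ≤ 8 * B ∨ u ^ 2 * N ≤ 32 * B * μ ^ 2 * (Real.log A + (p + 6) * Real.log (2 * N + 3)) ∨
      u ^ 3 * N ≤ 128 * B * μ ^ 4 * c ^ 2 := by
  have hμ0 : 0 < μ := by linarith
  have hB0 : 0 < B := by linarith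
  have hA0 : 0 < A := by linarith
  have hN1 : 1 ≤ N := by omega
  have hNr : (1 : ℝ) ≤ N := by exact_mod_cast hN1
  have hN0 : (0 : ℝ) < N := by linarith
  -- `u < μ²`
  have hφpos : 0 < a (N + 2) / a N := div_pos (ha _) (ha _)
  have huμ : u < μ ^ 2 := by linarith
  by_cases hsmall : u * N / (4 * B) < 2
  · left
    rw [div_lt_iff₀ (by positivity)] at hsmall; linarith
  · right
    push Not at hsmall
    obtain ⟨hM2, h4MB, hMy'⟩ := blocks_facts hB0 hsmall
    set M : ℕ := ⌊u * N / (4 * B)⌋₊ with hMdef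
    have hMr2 : (2 : ℝ) ≤ M := by exact_mod_cast hM2
    have hM0 : (0 : ℝ) < M := by linarith
    -- `4M ≤ N`
    have h4M : 4 * M ≤ N := by
      have : 4 * (M : ℝ) ≤ N := by
        have h1 : 4 * (M : ℝ) * B ≤ B * N := by
          calc 4 * (M : ℝ) * B ≤ u * N := h4MB
            _ ≤ B * N := mul_le_mul_of_nonneg_right (by linarith) hN0.le
        have h2 : 4 * (M : ℝ) * B ≤ N * B := by linarith
        exact le_of_mul_le_mul_right h2 hB0
      exact_mod_cast this
    -- `N' = N - 2M ≥ n₁`, of parity `r`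
    obtain ⟨N', hN'⟩ : ∃ N', N = N' + 2 * M := ⟨N - 2 * M, by omega⟩
    have hN'1 : n₁ ≤ N' := by omega
    have hN'one : 1 ≤ N' := by omega
    have hN'par : N' % 2 = r := by omega
    have h2M : 2 * M ≤ N' := by omega
    -- the product bound
    rw [hN'] at hdev
    have hprod := KestenRateLower.lower_dev_prod ha (by linarith) hK hN'one h2M hu hdev
      (by push_cast [hN'] at h4MB ⊢; linarith)
    set q : ℝ := μ ^ 2 - u / 2 with hq
    have hq0 : 0 < q := by rw [hq]; linarith
    -- insertion at `(N', M)`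
    have hSM' := hSM N' M hN'1 hN'par hM2
    have ecast : (2 * ((N' : ℝ) + 2 * (M : ℝ)) + 3) = 2 * (N : ℝ) + 3 := by rw [hN']; push_cast; ring
    rw [ecast] at hSM'
    set P : ℝ := (2 * (N : ℝ) + 3) ^ 6 with hP
    have hP0 : 0 < P := by positivity
    -- `e M ≤ P q^M`
    have ham : e M ≤ P * q ^ M := by
      have h1 : a N' * e M ≤ P * (q ^ M * a N') := hSM'.trans (mul_le_mul_of_nonneg_left hprod (by positivity))
      have h2 : a N' * e M ≤ a N' * (P * q ^ M) := by linarith [h1]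
      exact le_of_mul_le_mul_left h2 (ha N')
    -- the envelope of `e` at `M`
    have hAM : 0 ≤ A * (M : ℝ) ^ p := by positivity
    have henv := (hlo M hM2).trans (mul_le_mul_of_nonneg_left ham hAM)
    -- logs: `M (-log(1 - x)) ≤ log A + p log M + log P + c√M`, `x = u/(2μ²)`
    set x : ℝ := u / (2 * μ ^ 2) with hx
    have hx0 : 0 < x := by positivity
    have hx1 : x < 1 := by
      rw [hx, div_lt_one (by positivity)]
      have : (0 : ℝ) ≤ μ ^ 2 := sq_nonneg μ
      linarith
    have hqx : q = μ ^ 2 * (1 - x) := by rw [hq, hx]; field_simp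
    have hlog1 : (M : ℝ) * -Real.log (1 - x) ≤
        Real.log A + (p : ℝ) * Real.log M + Real.log P + c * Real.sqrt M := by
      have hpos1 : 0 < Real.exp (-(c * Real.sqrt M)) * μ ^ (2 * M) := by positivity
      have h := Real.log_le_log hpos1 henv
      have hL : Real.log (Real.exp (-(c * Real.sqrt M)) * μ ^ (2 * M)) =
          -(c * Real.sqrt M) + (2 * (M : ℝ)) * Real.log μ := by
        rw [Real.log_mul (Real.exp_pos _).ne' (by positivity), Real.log_exp, Real.log_pow]; push_cast; ring
      have hlogq : Real.log q = 2 * Real.log μ + Real.log (1 - x) := by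
        rw [hqx, Real.log_mul (by positivity) (by linarith), Real.log_pow]; push_cast; ring
      have hRlog : Real.log (A * (M : ℝ) ^ p * (P * q ^ M)) =
          Real.log A + (p : ℝ) * Real.log M + Real.log P + (M : ℝ) * (2 * Real.log μ + Real.log (1 - x)) := by
        rw [Real.log_mul (by positivity) (by positivity), Real.log_mul hA0.ne' (by positivity),
          Real.log_pow, Real.log_mul hP0.ne' (pow_pos hq0 M).ne', Real.log_pow (n := M), hlogq]
        ring
      rw [hL, hRlog] at h
      linarith [h]
    have hlog2 : x ≤ -Real.log (1 - x) := le_neg_log_one_sub hx1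
    have hlogP : Real.log P = 6 * Real.log (2 * (N : ℝ) + 3) := by rw [hP, Real.log_pow]; push_cast; ring
    have hlogM : Real.log (M : ℝ) ≤ Real.log (2 * (N : ℝ) + 3) := by
      apply Real.log_le_log hM0
      have : (M : ℝ) ≤ N := by exact_mod_cast (show M ≤ N by omega)
      linarith
    have hlogN0 : 0 ≤ Real.log (2 * (N : ℝ) + 3) := Real.log_nonneg (by linarith)
    set RN : ℝ := Real.log A + ((p : ℝ) + 6) * Real.log (2 * (N : ℝ) + 3) with hRN
    have hRN0 : 0 ≤ RN := by
      have := Real.log_nonneg hA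
      rw [hRN]; positivity
    have hmain : (M : ℝ) * x ≤ RN + c * Real.sqrt M := by
      have h1 : (M : ℝ) * x ≤ (M : ℝ) * -Real.log (1 - x) := mul_le_mul_of_nonneg_left hlog2 hM0.le
      have h2 : (p : ℝ) * Real.log M ≤ (p : ℝ) * Real.log (2 * (N : ℝ) + 3) :=
        mul_le_mul_of_nonneg_left hlogM (Nat.cast_nonneg p)
      rw [hRN]
      nlinarith [h1, h2, hlog1, hlogP]
    -- case split on the dominant term
    rcases le_or_gt ((M : ℝ) * x) (2 * RN) with hA' | hB'
    · -- (A): `u² N ≤ 32 B μ² RN`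
      left
      have h2 : u * N / (8 * B) * x ≤ 2 * RN := le_trans (mul_le_mul_of_nonneg_right hMy' hx0.le) hA'
      rw [hx, aux_A u N B μ hB0 hμ0, div_le_iff₀ (by positivity)] at h2
      exact h2.trans (le_of_eq (by ring))
    · -- (B): `M x ≤ 2 c √M` ⇒ `M x² ≤ 4 c²` ⇒ `u³ N ≤ 128 B μ⁴ c²`
      right
      have h1 : (M : ℝ) * x ≤ 2 * c * Real.sqrt M := by linarith
      have hsM : Real.sqrt (M : ℝ) ^ 2 = M := Real.sq_sqrt hM0.le
      have h2 : (M : ℝ) * x ^ 2 ≤ 4 * c ^ 2 := by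
        have hl : 0 ≤ (M : ℝ) * x := by positivity
        have h3 : ((M : ℝ) * x) ^ 2 ≤ (2 * c * Real.sqrt M) ^ 2 := pow_le_pow_left₀ hl h1 2
        have e : (2 * c * Real.sqrt (M : ℝ)) ^ 2 = 4 * c ^ 2 * M := by rw [mul_pow, mul_pow, hsM]; ring
        rw [e] at h3
        have e2 : ((M : ℝ) * x) ^ 2 = (M : ℝ) * ((M : ℝ) * x ^ 2) := by ring
        rw [e2] at h3
        have h4 : (M : ℝ) * ((M : ℝ) * x ^ 2) ≤ (M : ℝ) * (4 * c ^ 2) := by linarith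
        exact le_of_mul_le_mul_left h4 hM0
      have h4 : u * N / (8 * B) * x ^ 2 ≤ 4 * c ^ 2 :=
        le_trans (mul_le_mul_of_nonneg_right hMy' (by positivity)) h2
      rw [hx, aux_B u N B μ hB0 hμ0, div_le_iff₀ (by positivity)] at h4
      linarith

/-! ### The planar loop lower envelope, all `M ≥ 2`, explicit -/

/-- **All-`M` explicit lower envelope for walks closing next to the origin on `ℤ²`**:
`e^{-12√M} μ^{2M} ≤ 4 μ⁴ M⁶ c_{2M−1}(0,−e₂)` for every `M ≥ 2` — from `μ^{M−2} ≤ c_{M−2} ≤ (M−1) e^{6√(M−1)} b_{M−1}`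
(`pow_connectiveConstant_le_count`, `count_le_mul_exp_mul_bridgeCount`) and Theorem 3.2.4
`b_{M−1}² ≤ (2M−1)² M² c_{2M−1}(0,−e₂)` (`MadrasSlade1993_thm324_general`), with `(M−1)²(2M−1)² M² ≤ 4M⁶`.
[cite: MadrasSlade1993, Corollary 3.2.5, eq. (3.2.8) (p. 67) with Theorem 3.2.4 and Corollary 3.1.6 (explicit, all M)] -/
theorem loop_lower_envelope_two {M : ℕ} (hM : 2 ≤ M) :
    Real.exp (-(12 * Real.sqrt M)) * connectiveConstant 2 ^ (2 * M) ≤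
      4 * connectiveConstant 2 ^ 4 * (M : ℝ) ^ 6 * (countAt 2 (2 * M - 1) eNeg : ℝ) := by
  obtain ⟨k, rfl⟩ : ∃ k, M = k + 2 := ⟨M - 2, by omega⟩
  set μ := connectiveConstant 2 with hμdef
  have hμ0 : 0 < μ := connectiveConstant_pos 2
  -- `μ^k ≤ c_k ≤ (k+1) e^{6√(k+1)} b_{k+1}`
  have h1 : μ ^ k ≤ (count 2 k : ℝ) := pow_connectiveConstant_le_count 2 k
  have h2 : (count 2 k : ℝ) ≤ ((k : ℝ) + 1) * Real.exp (6 * Real.sqrt ((k : ℝ) + 1)) * bridgeCount 2 (k + 1) :=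
    count_le_mul_exp_mul_bridgeCount (d := 2) k
  -- Theorem 3.2.4 at `k+1`
  have h3 : ((bridgeCount 2 (k + 1) : ℝ)) ^ 2 ≤
      (2 * ((k : ℝ) + 1) + 1) ^ 2 * (((k : ℝ) + 1) + 1) ^ 2 * (countAt 2 (2 * (k + 1) + 1) eNeg : ℝ) := by
    have := MadrasSlade1993_thm324_general (d := 2) le_rfl (M := k + 1) (by omega)
    exact_mod_cast this
  have e23 : 2 * (k + 2) - 1 = 2 * (k + 1) + 1 := by omega
  rw [e23]
  set C : ℝ := (countAt 2 (2 * (k + 1) + 1) eNeg : ℝ) with hC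
  have hC0 : 0 ≤ C := Nat.cast_nonneg _
  have hb0 : (0 : ℝ) ≤ bridgeCount 2 (k + 1) := Nat.cast_nonneg _
  have hk0 : (0 : ℝ) ≤ k := Nat.cast_nonneg _
  set s : ℝ := Real.sqrt ((k : ℝ) + 1) with hs
  -- `μ^{2k} ≤ (k+1)² e^{12 s} b² ≤ (k+1)² e^{12 s} (2k+3)² (k+2)² C`
  have h12 : μ ^ k ≤ ((k : ℝ) + 1) * Real.exp (6 * s) * bridgeCount 2 (k + 1) := h1.trans h2
  have hsq : μ ^ (2 * k) ≤ ((k : ℝ) + 1) ^ 2 * Real.exp (12 * s) * (bridgeCount 2 (k + 1) : ℝ) ^ 2 := by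
    have := pow_le_pow_left₀ (pow_nonneg hμ0.le k) h12 2
    rw [← pow_mul, mul_comm k 2] at this
    refine this.trans (le_of_eq ?_)
    rw [mul_pow, mul_pow, ← Real.exp_nat_mul]; push_cast; ring_nf
  have hmain : μ ^ (2 * k) ≤ ((k : ℝ) + 1) ^ 2 * Real.exp (12 * s) *
      ((2 * ((k : ℝ) + 1) + 1) ^ 2 * (((k : ℝ) + 1) + 1) ^ 2 * C) :=
    hsq.trans (mul_le_mul_of_nonneg_left h3 (by positivity))
  -- `e^{-12√(k+2)} e^{12 s} ≤ 1`
  have hexp : Real.exp (-(12 * Real.sqrt (((k + 2 : ℕ) : ℝ)))) * Real.exp (12 * s) ≤ 1 := by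
    rw [← Real.exp_add, Real.exp_le_one_iff]
    have : s ≤ Real.sqrt (((k + 2 : ℕ) : ℝ)) := by
      rw [hs]; exact Real.sqrt_le_sqrt (by push_cast; linarith)
    linarith
  -- the polynomial: `(k+1)² (2k+3)² (k+2)² ≤ 4 (k+2)⁶`
  have hpoly : ((k : ℝ) + 1) ^ 2 * ((2 * ((k : ℝ) + 1) + 1) ^ 2 * (((k : ℝ) + 1) + 1) ^ 2) ≤
      4 * (((k + 2 : ℕ) : ℝ)) ^ 6 := by
    push_cast
    have h5 : ((k : ℝ) + 1) * (2 * ((k : ℝ) + 1) + 1) ≤ 2 * ((k : ℝ) + 2) ^ 2 := by nlinarith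
    have h6 : 0 ≤ ((k : ℝ) + 1) * (2 * ((k : ℝ) + 1) + 1) := by positivity
    have h7 := mul_le_mul h5 h5 h6 (by positivity)
    nlinarith [h7, pow_nonneg (show (0:ℝ) ≤ (k : ℝ) + 2 by positivity) 2,
      mul_nonneg (mul_nonneg h6 h6) (pow_nonneg (show (0:ℝ) ≤ (k : ℝ) + 2 by positivity) 2)]
  -- assemble
  have e2 : μ ^ (2 * (k + 2)) = μ ^ 4 * μ ^ (2 * k) := by rw [← pow_add]; ring_nf
  rw [e2]
  calc Real.exp (-(12 * Real.sqrt (((k + 2 : ℕ) : ℝ)))) * (μ ^ 4 * μ ^ (2 * k))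
      ≤ Real.exp (-(12 * Real.sqrt (((k + 2 : ℕ) : ℝ)))) * (μ ^ 4 * (((k : ℝ) + 1) ^ 2 * Real.exp (12 * s) *
          ((2 * ((k : ℝ) + 1) + 1) ^ 2 * (((k : ℝ) + 1) + 1) ^ 2 * C))) := by
        gcongr
    _ = (Real.exp (-(12 * Real.sqrt (((k + 2 : ℕ) : ℝ)))) * Real.exp (12 * s)) *
          (μ ^ 4 * (((k : ℝ) + 1) ^ 2 * ((2 * ((k : ℝ) + 1) + 1) ^ 2 * (((k : ℝ) + 1) + 1) ^ 2)) * C) := by ring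
    _ ≤ 1 * (μ ^ 4 * (4 * (((k + 2 : ℕ) : ℝ)) ^ 6) * C) := by
        apply mul_le_mul hexp _ (by positivity) (by norm_num)
        apply mul_le_mul_of_nonneg_right _ hC0
        exact mul_le_mul_of_nonneg_left hpoly (by positivity)
    _ = 4 * μ ^ 4 * (((k + 2 : ℕ) : ℝ)) ^ 6 * C := by ring

/-! ### The planar instances of the two case lemmas -/

/-- **Upper deviation on `ℤ²`, case form**: if `N ≥ 1`, `0 < u ≤ μ²` and `μ² + u ≤ c_{N+2}/c_N`, then `uN ≤ 8B`, or
`u²N ≤ 48 B μ² log(μ² e^{1+π})`, or `u³N ≤ 288 B μ⁴ (4+2π)²` (`B = kestenB 0 63 2.43`; inputs `kestenIneqZ2_sharp_25`,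
submultiplicativity, `RatioRateAllDim.count_two_mul_le_envelope`).
[cite: MadrasSlade1993, §7.5, eq. (7.5.1) (upper side, planar, explicit)] -/
theorem upper_cases_two {N : ℕ} (hN : 1 ≤ N) {u : ℝ} (hu : 0 < u) (huμ : u ≤ connectiveConstant 2 ^ 2)
    (hdev : connectiveConstant 2 ^ 2 + u ≤ (count 2 (N + 2) : ℝ) / count 2 N) :
    u * N ≤ 8 * KestenHairpin.kestenB 0 63 2.43 ∨
      u ^ 2 * N ≤ 48 * KestenHairpin.kestenB 0 63 2.43 * connectiveConstant 2 ^ 2 *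
        Real.log (connectiveConstant 2 * Real.exp (1 + Real.pi + Real.log (connectiveConstant 2))) ∨
      u ^ 3 * N ≤ 288 * KestenHairpin.kestenB 0 63 2.43 * connectiveConstant 2 ^ 4 * (4 + 2 * Real.pi) ^ 2 := by
  set μ := connectiveConstant 2 with hμdef
  have hμ1 : 1 ≤ μ := one_le_connectiveConstant 2
  have ha : ∀ n, (0 : ℝ) < count 2 n := fun n => by exact_mod_cast one_le_count 2 n
  have hB1 : (1 : ℝ) ≤ KestenHairpin.kestenB 0 63 2.43 := le_trans (by norm_num) nine_le_kestenB_sharp_25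
  have hK : ∀ n : ℕ, 1 ≤ n →
      (count 2 (n + 2) : ℝ) / count 2 n - KestenHairpin.kestenB 0 63 2.43 / n ≤ (count 2 (n + 4) : ℝ) / count 2 (n + 2) :=
    KestenHairpin.kestenIneqZ2_sharp_25
  have hsub : ∀ N M : ℕ, (count 2 (N + 2 * M) : ℝ) ≤ count 2 N * count 2 (2 * M) := fun N M => by
    exact_mod_cast count_add_le 2 N (2 * M)
  have hA1 : 1 ≤ μ * Real.exp (1 + Real.pi + Real.log μ) := by
    have hl := Real.log_nonneg hμ1
    have : 1 ≤ Real.exp (1 + Real.pi + Real.log μ) := Real.one_le_exp (by linarith [Real.pi_pos])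
    nlinarith
  have hhi : ∀ M : ℕ, (count 2 (2 * M) : ℝ) ≤
      (μ * Real.exp (1 + Real.pi + Real.log μ)) * Real.exp ((4 + 2 * Real.pi) * Real.sqrt M) * μ ^ (2 * M) :=
    fun M => RatioRateAllDim.count_two_mul_le_envelope 0 M
  exact upper_rate_cases (a := fun n => (count 2 n : ℝ)) (a₂ := fun M => (count 2 (2 * M) : ℝ))
    ha hμ1 hB1 hA1 hK hsub hhi hN hu huμ hdev

/-- The planar insertion inequality in the shape consumed here (`RatioRateAllDim.insertion_hSM` at `d = 0`):
`c_{N'} · (c_{2M−1}(0,−e₂)/160) ≤ (2(N'+2M)+3)⁶ c_{N'+2M}` for `N' ≥ 1`, `M ≥ 2`.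
[cite: MadrasSlade1993, §7.5, eq. (7.5.1) (lower side: the super-multiplicative input); Corollary 3.2.6 (proof)] -/
theorem insertion_two (N' M : ℕ) (hN' : 1 ≤ N') (hM : 2 ≤ M) :
    (count 2 N' : ℝ) * ((countAt 2 (2 * M - 1) eNeg : ℝ) / 160) ≤
      (2 * ((N' : ℝ) + 2 * M) + 3) ^ 6 * (count 2 (N' + 2 * M) : ℝ) := by
  have h := RatioRateAllDim.insertion_hSM 0 N' M hN' hM
  norm_num at h
  convert h using 2

/-- **Lower deviation on `ℤ²`, case form**: if `N ≥ 3`, `u > 0` and `c_{N+2}/c_N ≤ μ² − u`, then `uN ≤ 8B`, or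
`u²N ≤ 32 B μ² (log(640 μ⁴) + 12 log(2N+3))`, or `u³N ≤ 128 B μ⁴ · 12²` (`B = kestenB 0 63 2.43`; inputs
`kestenIneqZ2_sharp_25`, `loop_lower_envelope_two`, `insertion_two`).
[cite: MadrasSlade1993, §7.5, eq. (7.5.1) (lower side, planar, explicit)] -/
theorem lower_cases_two {N : ℕ} (hN : 3 ≤ N) {u : ℝ} (hu : 0 < u)
    (hdev : (count 2 (N + 2) : ℝ) / count 2 N ≤ connectiveConstant 2 ^ 2 - u) :
    u * N ≤ 8 * KestenHairpin.kestenB 0 63 2.43 ∨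
      u ^ 2 * N ≤ 32 * KestenHairpin.kestenB 0 63 2.43 * connectiveConstant 2 ^ 2 *
        (Real.log (640 * connectiveConstant 2 ^ 4) + 12 * Real.log (2 * (N : ℝ) + 3)) ∨
      u ^ 3 * N ≤ 128 * KestenHairpin.kestenB 0 63 2.43 * connectiveConstant 2 ^ 4 * 12 ^ 2 := by
  set μ := connectiveConstant 2 with hμdef
  have hμ1 : 1 ≤ μ := one_le_connectiveConstant 2
  have hμ3 : μ ≤ 3 := mu_two_bounds.2
  have ha : ∀ n, (0 : ℝ) < count 2 n := fun n => by exact_mod_cast one_le_count 2 n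
  have hB9 : (9 : ℝ) ≤ KestenHairpin.kestenB 0 63 2.43 := nine_le_kestenB_sharp_25
  have hB1 : (1 : ℝ) ≤ KestenHairpin.kestenB 0 63 2.43 := le_trans (by norm_num) hB9
  have hBμ : μ ^ 2 ≤ KestenHairpin.kestenB 0 63 2.43 := by nlinarith
  have hK : ∀ n : ℕ, 1 ≤ n →
      (count 2 (n + 2) : ℝ) / count 2 n - KestenHairpin.kestenB 0 63 2.43 / n ≤ (count 2 (n + 4) : ℝ) / count 2 (n + 2) :=
    KestenHairpin.kestenIneqZ2_sharp_25
  have hA1 : (1 : ℝ) ≤ 640 * μ ^ 4 := by nlinarith [one_le_pow₀ (n := 4) hμ1]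
  have hlo : ∀ M : ℕ, 2 ≤ M → Real.exp (-(12 * Real.sqrt M)) * μ ^ (2 * M) ≤
      (640 * μ ^ 4) * (M : ℝ) ^ 6 * ((countAt 2 (2 * M - 1) eNeg : ℝ) / 160) := by
    intro M hM
    have h := loop_lower_envelope_two hM
    rw [← hμdef] at h
    refine h.trans (le_of_eq ?_)
    ring
  have hSM : ∀ N' M : ℕ, 1 ≤ N' → N' % 2 = N % 2 → 2 ≤ M →
      (count 2 N' : ℝ) * ((countAt 2 (2 * M - 1) eNeg : ℝ) / 160) ≤
        (2 * ((N' : ℝ) + 2 * M) + 3) ^ 6 * (count 2 (N' + 2 * M) : ℝ) :=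
    fun N' M hN' _ hM => insertion_two N' M hN' hM
  have h := lower_rate_cases (a := fun n => (count 2 n : ℝ)) (e := fun M => (countAt 2 (2 * M - 1) eNeg : ℝ) / 160)
    (p := 6) (n₁ := 1) (r := N % 2) ha hμ1 hB1 hBμ hA1 hK hlo hSM (by omega) rfl hu hdev
  have e12 : ((6 : ℕ) : ℝ) + 6 = 12 := by norm_num
  rw [e12] at h
  exact h

/-! ### Numerical bounds for the planar constants -/

/-- `log μ ≤ 2` (`log μ ≤ μ − 1`, `μ ≤ 3`). [cite: BDGS2012, §1.3, eq. (1.13)] -/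
private theorem log_mu_two_le_two : Real.log (connectiveConstant 2) ≤ 2 := by
  have h := Real.log_le_sub_one_of_pos (connectiveConstant_pos 2)
  linarith [mu_two_bounds.2]

/-- The upper-envelope log-constant: `log(μ · e^{1+π+log μ}) ≤ 33/4`. [cite: MadrasSlade1993, Theorem 3.1.1 (Hammersley–Welsh bound)] -/
private theorem log_envelopeA_le :
    Real.log (connectiveConstant 2 * Real.exp (1 + Real.pi + Real.log (connectiveConstant 2))) ≤ 33 / 4 := by
  have hμ0 := connectiveConstant_pos 2
  rw [Real.log_mul hμ0.ne' (Real.exp_pos _).ne', Real.log_exp]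
  linarith [log_mu_two_le_two, Real.pi_lt_d2]

/-- `(4 + 2π)² ≤ 106.09`. [folklore] -/
private theorem hw_c_sq_le : (4 + 2 * Real.pi) ^ 2 ≤ 106.09 := by
  have h1 : 4 + 2 * Real.pi ≤ 10.3 := by linarith [Real.pi_lt_d2]
  have h0 : 0 ≤ 4 + 2 * Real.pi := by linarith [Real.pi_pos]
  nlinarith

/-- `log(640 μ⁴) ≤ 11` (`640 · 3⁴ = 51840 ≤ 2.7¹¹ ≤ e¹¹`). [folklore] -/
private theorem log_loopA_le : Real.log (640 * connectiveConstant 2 ^ 4) ≤ 11 := by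
  obtain ⟨hlo, hhi⟩ := mu_two_bounds
  have hμ0 := connectiveConstant_pos 2
  have h1 : 640 * connectiveConstant 2 ^ 4 ≤ 51840 := by
    have : connectiveConstant 2 ^ 4 ≤ 3 ^ 4 := pow_le_pow_left₀ hμ0.le hhi 4
    nlinarith
  have h2 : (51840 : ℝ) ≤ Real.exp 11 := by
    have he : (2.7 : ℝ) ≤ Real.exp 1 := by linarith [Real.exp_one_gt_d9]
    have h3 : (2.7 : ℝ) ^ 11 ≤ Real.exp 1 ^ 11 := pow_le_pow_left₀ (by norm_num) he 11
    have e11 : Real.exp 1 ^ 11 = Real.exp 11 := by rw [Real.exp_one_pow]; norm_num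
    rw [← e11]
    exact le_trans (by norm_num) h3
  rw [Real.log_le_iff_le_exp (by positivity)]
  exact h1.trans h2

/-- The cube root versus the threshold `10⁵`: if `N^{1/3} ≥ 10⁵` then `N ≥ 10¹⁵` and
`log(2N+3) ≤ 32.36 + 3 N^{1/3}/10⁵` (`log(2·10¹⁵+3) ≤ 51 log 2`, `log((2N+3)/(2·10¹⁵+3)) ≤ log(N/10¹⁵) = 3 log(t/10⁵) ≤ 3(t/10⁵ − 1)`).
[folklore] -/
private theorem log_two_N_three_le {N t : ℝ} (ht0 : 0 < t) (ht3 : t ^ 3 = N) (ht : 1e5 ≤ t) :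
    Real.log (2 * N + 3) ≤ 32.36 + 3 * t / 1e5 := by
  have hN : (1e15 : ℝ) ≤ N := by
    rw [← ht3]; nlinarith [pow_le_pow_left₀ (by norm_num) ht 3]
  have hN0 : 0 < N := by linarith
  -- `log(2·10¹⁵ + 3) ≤ 51 log 2 ≤ 35.351`
  have hA : Real.log (2 * 1e15 + 3) ≤ 35.351 := by
    have h1 : (2 * 1e15 + 3 : ℝ) ≤ 2 ^ 51 := by norm_num
    have h2 : Real.log (2 * 1e15 + 3) ≤ Real.log ((2 : ℝ) ^ 51) := Real.log_le_log (by norm_num) h1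
    rw [Real.log_pow] at h2
    have h3 := Real.log_two_lt_d9
    push_cast at h2
    nlinarith
  -- `log(2N+3) - log(2·10¹⁵+3) ≤ log N - log 10¹⁵ = 3 (log t - log 10⁵) ≤ 3 (t/10⁵ - 1)`
  have hB : Real.log (2 * N + 3) - Real.log (2 * 1e15 + 3) ≤ Real.log N - Real.log 1e15 := by
    rw [← Real.log_div (by linarith) (by norm_num), ← Real.log_div hN0.ne' (by norm_num)]
    apply Real.log_le_log (by positivity)
    rw [div_le_div_iff₀ (by norm_num) (by norm_num)]
    nlinarith
  have hC : Real.log N - Real.log 1e15 = 3 * (Real.log t - Real.log 1e5) := by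
    rw [← ht3, Real.log_pow, show (1e15 : ℝ) = 1e5 ^ 3 by norm_num, Real.log_pow]; push_cast; ring
  have hD : Real.log t - Real.log 1e5 ≤ t / 1e5 - 1 := by
    rw [← Real.log_div ht0.ne' (by norm_num)]
    have := Real.log_le_sub_one_of_pos (show 0 < t / 1e5 by positivity)
    linarith
  linarith

/-! ### The numeral Kesten rate on `ℤ²` -/

/-- **Kesten's ratio rate on `ℤ²` with the printed exponent and a numeral constant** (Madras–Slade (7.5.1), Kesten 1963):
for every `N ≥ 1`, `|c_{N+2}/c_N − μ²| ≤ 10⁶ · N^{-1/3}` (standard axioms; `B = kestenB 0 63 2.43 ≤ 2.92·10¹¹`, `5/2 ≤ μ ≤ 3`;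
vacuous below `N ≈ 10¹⁵`, where `|c_{N+2}/c_N − μ²| ≤ 8` trivially).  Print has "`≤ K N^{-1/3}` for all sufficiently large `N`"
with `K` inexplicit; the tree's planar `ratioRate_Z2_sharp_25_numeric` has the weaker rate `1.07·10⁷ √((G(2N)+1)/N)`.
[cite: MadrasSlade1993, §7.5 Notes, eq. (7.5.1) (p. 255); Grimmett2021Kesten, §5, Theorem 13(a); Kesten1963SAW] -/
theorem _root_.Literature.Probability.RandomPlanarGeometry.SAW.Zd.ratioRate_two_cubeRoot_numeral {N : ℕ} (hN : 1 ≤ N) :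
    |(count 2 (N + 2) : ℝ) / count 2 N - connectiveConstant 2 ^ 2| ≤ 1e6 * (N : ℝ) ^ (-(1 : ℝ) / 3) := by
  set μ := connectiveConstant 2 with hμdef
  obtain ⟨hμlo, hμhi⟩ := mu_two_bounds
  have hμ0 : 0 < μ := connectiveConstant_pos 2
  have hB : KestenHairpin.kestenB 0 63 2.43 ≤ 2.92e11 := kestenB_sharp_25_le'
  have hB0 : 0 ≤ KestenHairpin.kestenB 0 63 2.43 := le_trans (by norm_num) nine_le_kestenB_sharp_25
  have ha : ∀ n, (0 : ℝ) < count 2 n := fun n => by exact_mod_cast one_le_count 2 n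
  have hNr : (1 : ℝ) ≤ N := by exact_mod_cast hN
  have hN0 : (0 : ℝ) < N := by linarith
  obtain ⟨ht0, ht1, ht3, htinv⟩ := cubeRoot_facts hNr
  set t : ℝ := (N : ℝ) ^ ((1 : ℝ) / 3) with htdef
  rw [htinv, ← div_eq_mul_inv, le_div_iff₀ ht0]
  set φ : ℝ := (count 2 (N + 2) : ℝ) / count 2 N with hφ
  have hφ12 : φ ≤ 12 := by
    rw [hφ, div_le_iff₀ (ha N)]; exact count_add_two_le_twelve_mul N
  have hφ1 : 1 ≤ φ := by
    rw [hφ, le_div_iff₀ (ha N), one_mul]; exact_mod_cast count_le_count_add_two 2 N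
  have hμ2lo : (25 / 4 : ℝ) ≤ μ ^ 2 := by nlinarith
  have hμ2hi : μ ^ 2 ≤ 9 := by nlinarith
  have hμ4hi : μ ^ 4 ≤ 81 := by nlinarith
  have hK0 : (0 : ℝ) ≤ 1e6 := by norm_num
  rcases le_or_gt (μ ^ 2) φ with hup | hlow
  · -- upper deviation `u = φ - μ²`
    rw [abs_of_nonneg (by linarith)]
    set u : ℝ := φ - μ ^ 2 with hu
    rcases eq_or_lt_of_le (show 0 ≤ u by rw [hu]; linarith) with h0 | hu0
    · rw [← h0, zero_mul]; norm_num
    have huU : u ≤ 23 / 4 := by rw [hu]; linarith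
    have huμ : u ≤ μ ^ 2 := by linarith
    have hut0 : 0 ≤ u * t := by positivity
    apply le_of_cube_le_cube hK0
    have e18 : (1e6 : ℝ) ^ 3 = 1e18 := by norm_num
    rw [e18]
    rcases upper_cases_two hN hu0 huμ (by rw [hu]; linarith) with h1 | h2 | h3
    · -- `uN ≤ 8B`
      have e : (u * t) ^ 3 = u ^ 2 * (u * N) := by rw [← ht3]; ring
      rw [e]
      have hu2 : u ^ 2 ≤ (23 / 4) ^ 2 := pow_le_pow_left₀ hu0.le huU 2
      calc u ^ 2 * (u * N) ≤ (23 / 4) ^ 2 * (8 * KestenHairpin.kestenB 0 63 2.43) := mul_le_mul hu2 h1 (by positivity) (by positivity)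
        _ ≤ (23 / 4) ^ 2 * (8 * 2.92e11) :=
            mul_le_mul_of_nonneg_left (mul_le_mul_of_nonneg_left hB (by norm_num)) (by positivity)
        _ ≤ 1e18 := by norm_num
    · -- `u²N ≤ 48 B μ² R`
      have e : (u * t) ^ 3 = u * (u ^ 2 * N) := by rw [← ht3]; ring
      rw [e]
      have hR := log_envelopeA_le
      have hR0 : 0 ≤ Real.log (μ * Real.exp (1 + Real.pi + Real.log μ)) := by
        apply Real.log_nonneg
        have : 1 ≤ Real.exp (1 + Real.pi + Real.log μ) :=
          Real.one_le_exp (by linarith [Real.pi_pos, Real.log_nonneg (one_le_connectiveConstant 2)])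
        nlinarith [one_le_connectiveConstant 2]
      have h2' : u ^ 2 * N ≤ 48 * 2.92e11 * 9 * (33 / 4) := by
        calc u ^ 2 * N ≤ 48 * KestenHairpin.kestenB 0 63 2.43 * μ ^ 2 * Real.log (μ * Real.exp (1 + Real.pi + Real.log μ)) := h2
          _ ≤ 48 * 2.92e11 * 9 * (33 / 4) :=
            mul_le_mul (mul_le_mul (mul_le_mul_of_nonneg_left hB (by norm_num : (0:ℝ) ≤ 48)) hμ2hi
              (by positivity) (by positivity)) hR hR0 (by positivity)
      calc u * (u ^ 2 * N) ≤ (23 / 4) * (48 * 2.92e11 * 9 * (33 / 4)) :=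
            mul_le_mul huU h2' (by positivity) (by norm_num)
        _ ≤ 1e18 := by norm_num
    · -- `u³N ≤ 288 B μ⁴ (4+2π)²`
      have e : (u * t) ^ 3 = u ^ 3 * N := by rw [← ht3]; ring
      rw [e]
      have hc := hw_c_sq_le
      calc u ^ 3 * N ≤ 288 * KestenHairpin.kestenB 0 63 2.43 * μ ^ 4 * (4 + 2 * Real.pi) ^ 2 := h3
        _ ≤ 288 * 2.92e11 * 81 * 106.09 :=
            mul_le_mul (mul_le_mul (mul_le_mul_of_nonneg_left hB (by norm_num : (0:ℝ) ≤ 288)) hμ4hi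
              (by positivity) (by positivity)) hc (by positivity) (by positivity)
        _ ≤ 1e18 := by norm_num
  · -- lower deviation `u = μ² - φ`
    rw [abs_of_neg (by linarith), neg_sub]
    set u : ℝ := μ ^ 2 - φ with hu
    have hu0 : 0 < u := by rw [hu]; linarith
    have huU : u ≤ 8 := by rw [hu]; linarith
    have hut0 : 0 ≤ u * t := by positivity
    by_cases hN3 : N < 3
    · -- `N ≤ 2`: `u t ≤ 8 N ≤ 16`
      have htN : t ≤ N := by
        have : t ≤ t ^ 3 := le_self_pow₀ ht1 (by norm_num)
        rw [ht3] at this; exact this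
      have hN2 : (N : ℝ) ≤ 2 := by exact_mod_cast (show N ≤ 2 by omega)
      calc u * t ≤ 8 * 2 := mul_le_mul huU (htN.trans hN2) ht0.le (by norm_num)
        _ ≤ 1e6 := by norm_num
    push Not at hN3
    rcases lower_cases_two hN3 hu0 (by rw [hu]; linarith) with h1 | h2 | h3
    · -- `uN ≤ 8B`
      apply le_of_cube_le_cube hK0
      have e : (u * t) ^ 3 = u ^ 2 * (u * N) := by rw [← ht3]; ring
      rw [e]
      have hu2 : u ^ 2 ≤ 8 ^ 2 := pow_le_pow_left₀ hu0.le huU 2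
      calc u ^ 2 * (u * N) ≤ 8 ^ 2 * (8 * KestenHairpin.kestenB 0 63 2.43) := mul_le_mul hu2 h1 (by positivity) (by positivity)
        _ ≤ 8 ^ 2 * (8 * 2.92e11) :=
            mul_le_mul_of_nonneg_left (mul_le_mul_of_nonneg_left hB (by norm_num)) (by positivity)
        _ ≤ 1e6 ^ 3 := by norm_num
    · -- `u²N ≤ 32 B μ² (log(640μ⁴) + 12 log(2N+3))`: crossover at `t = 10⁵`
      by_cases ht5 : t ≤ 1e5
      · calc u * t ≤ 8 * 1e5 := mul_le_mul huU ht5 ht0.le (by norm_num)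
          _ ≤ 1e6 := by norm_num
      · push Not at ht5
        have hL1 := log_loopA_le
        have hL2 := log_two_N_three_le ht0 ht3 ht5.le
        have hlogN0 : 0 ≤ Real.log (2 * (N : ℝ) + 3) := Real.log_nonneg (by linarith)
        have hL : Real.log (640 * μ ^ 4) + 12 * Real.log (2 * (N : ℝ) + 3) ≤ 400 + t / 2500 := by
          linarith
        have hL0 : 0 ≤ Real.log (640 * μ ^ 4) + 12 * Real.log (2 * (N : ℝ) + 3) := by
          have hμ41 : (1 : ℝ) ≤ μ ^ 4 := one_le_pow₀ (one_le_connectiveConstant 2)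
          have : 0 ≤ Real.log (640 * μ ^ 4) := Real.log_nonneg (by linarith)
          positivity
        have h2' : u ^ 2 * N ≤ 32 * 2.92e11 * 9 * (400 + t / 2500) :=
          calc u ^ 2 * N ≤ 32 * KestenHairpin.kestenB 0 63 2.43 * μ ^ 2 * (Real.log (640 * μ ^ 4) + 12 * Real.log (2 * (N : ℝ) + 3)) := h2
            _ ≤ 32 * 2.92e11 * 9 * (400 + t / 2500) :=
              mul_le_mul (mul_le_mul (mul_le_mul_of_nonneg_left hB (by norm_num : (0:ℝ) ≤ 32)) hμ2hi
                (by positivity) (by positivity)) hL hL0 (by positivity)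
        have e : u ^ 2 * N = (u * t) ^ 2 * t := by rw [← ht3]; ring
        rw [e] at h2'
        apply le_of_sq_le_sq' hK0
        -- `(ut)² t ≤ 8.4096e13 (400 + t/2500) ≤ 10¹² t` for `t ≥ 10⁵`
        have h6 : (32 * 2.92e11 * 9 * 400 : ℝ) ≤ (32 * 2.92e11 * 9 * 400 / 1e5) * t := by
          have := mul_le_mul_of_nonneg_left ht5.le (show (0 : ℝ) ≤ 32 * 2.92e11 * 9 * 400 / 1e5 by norm_num)
          linarith
        have h5 : (u * t) ^ 2 * t ≤ 1e6 ^ 2 * t := by linarith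
        exact le_of_mul_le_mul_right h5 ht0
    · -- `u³N ≤ 128 B μ⁴ 12²`
      apply le_of_cube_le_cube hK0
      have e : (u * t) ^ 3 = u ^ 3 * N := by rw [← ht3]; ring
      rw [e]
      calc u ^ 3 * N ≤ 128 * KestenHairpin.kestenB 0 63 2.43 * μ ^ 4 * 12 ^ 2 := h3
        _ ≤ 128 * 2.92e11 * 81 * 12 ^ 2 :=
            mul_le_mul_of_nonneg_right (mul_le_mul (mul_le_mul_of_nonneg_left hB (by norm_num : (0:ℝ) ≤ 128)) hμ4hi
              (by positivity) (by positivity)) (by positivity)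
        _ ≤ 1e6 ^ 3 := by norm_num

end RatioRateNumeral

end Literature.Probability.RandomPlanarGeometry.SAW.Zd
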